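import Literature.NumberTheory.GaloisRepresentations.SubgroupKummerMu
import Literature.NumberTheory.EllipticCurves.Kato2004.IwasawaH1ReductionPkNumberField
import HarnessLib

/-!
# Kato 2004 (Astérisque 295) §15.5–(15.6.1)–(15.12.1), the LEVEL brick: the twisting homomorphism
# `t_{ζ,e} : μ_N → E[N]`, `ζ^a ↦ a·e`, and the Kummer–cup class `κ_U(β) ∪ e := (t_{ζ,e})_* κ_U(β) ∈ H¹(U, E[N])`
# of a Kummer unit `β` of a subgroup `U ≤ Γ_K` fixing `ζ` and `e`

Topic `NumberTheory/EllipticCurves`, sub-directory `Kato2004` (namespace = path).  Definitions with bodies and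
theorems only: **no named fact is introduced** (D-0026); no instance, no notation, no `sorry`.  General field `K`,
general `E : WeierstrassCurve K`, general level `N ≥ 1`; NO complex multiplication, NO `p`, NO tower inside.

Kato's map (15.12.1) `𝐇¹(𝕌^{p^∞𝔣}) → 𝐇¹(T)` (p. 263) is, at finite level `K' ⊂ K(p^∞𝔣)` and modulo `p^k`, the composite
of the Kummer map `O_{K'}[1/p]^× → H¹(O_{K'}[1/p], ℤ/p^k(1))` ((15.6.1), p. 253: "`𝕌 ≅ 𝐇¹(ℤ_p(1))`", from the
Kummer sequence) with the twist `ℤ/p^k(1) ⊗ T(−1) → T/p^k`, i.e. — once a generator `ζ_k` of `μ_{p^k}` and an element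
`e` of `T` are fixed — with the homomorphism `ζ_k^a ↦ a·e_k`.  Over a layer `K' = K̄^U` whose group `U` FIXES `ζ_k`
and `e_k` this twist is `U`-equivariant, so the class `(t_{ζ,e})_* κ_U(β) ∈ H¹(U, E[p^k])` is defined by plain
functoriality of `H¹(U, ·)` in the coefficients (`mapH1AddHom`, `Kato2004/IwasawaH1Reduction.lean`) applied to the
subgroup Kummer class `κ_U(β)` of `GaloisRepresentations/SubgroupKummerMu.lean`.  This file is that LEVEL brick:

* §1 `muLog K N ζ hζ : MuCarrier K N →+ ZMod N` (discrete logarithm to the base `ζ`, Mathlib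
  `IsPrimitiveRoot.zmodEquivZPowers`), `MuCarrier.addMonoidHom_ext_of_isPrimitiveRoot` (homomorphisms out of the
  cyclic group `μ_N = ⟨ζ⟩` are determined by the image of `ζ`), `mu_apply_eq_self_of_smul_eq` (a `σ` fixing `ζ` acts
  trivially on `μ_N`).
* §2 ★ `muToTorsionHom E N ζ hζ hn e : MuCarrier K N →+ geomTorsion E n` (`(N : ℤ) = n`), `ζ^a ↦ a • e` (`ZMod.lift`); `_gen`,
  `_apply_eq_nsmul`, equivariance `muToTorsionHom_smul` for `σ` fixing `ζ` and `e`, and the LEVEL-CHANGE square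
  `f ∘ t_{ζ',e'} = t_{ζ,e} ∘ π` for `ζ'^d = ζ`, `d • e' = e`, `π(v) = v^d`, `f(P) = d • P` (`comp_muToTorsionHom_eq`) —
  the `p_*`-compatibility brick (`d = p`, `π = muPowMap`, `f = geomTorsionReduce`).
* §3 ★ `kummerCupLevelClass E N U ζ hζ hn e hUζ hUe β : H1 (E.torsionGaloisModule n) U` := `(t_{ζ,e})_* κ_U(β)`; additive in
  `β`, depends on `β^N` only, vanishes for `U`-fixed `β`; `resLe` (smaller subgroup), `coresLe` between two subgroups
  BOTH fixing `ζ, e` = class of the norm element / of any root of the norm (`coresLe_kummerCupLevelClass{,_eq_of_pow_eq}`,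
  from `coresLe_muSubgroupKummerClass` + `mapH1AddHom_coresLe`), the level-change formula
  `f_* (κ_{U,M}(β') ∪ e') = κ_{U,N}(β'^d) ∪ e` (`mapH1AddHom_kummerCupLevelClass_of_pow`), and integrality
  ★ `kummerCupLevelClass_mem_integralH1K`: if `β` times a `U`-fixed unit is a `𝔓`-unit of `ℤ̄_K` at every `𝔓 ∤ p`
  (`N = p^k`), the class lies in `CM.integralH1K (E.torsionGaloisModule (p^k)) p U` (T1a §5 + `mapH1AddHom_resLe`).

LEVEL CONVENTION: the `μ`-level is a natural number `N ≥ 1` (`MuCarrier K N`, `IsPrimitiveRoot ζ N`), the torsion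
level an integer `n` with `(N : ℤ) = n` (hypothesis `hn`), so that both tree conventions `E[N] = geomTorsion E (N : ℤ)`
and `E[p^k] = geomTorsion E ((p : ℤ) ^ k)` (`HeegnerModuleIndex`, `Kato2004/IwasawaH1ReductionPkNumberField`) are served
without casts (`hn := rfl`, resp. `hn := Nat.cast_pow p k`).  Dictionary `ℚ ↔ K`: none needed (curve-generic). 
GENERALISE-VS-DUPLICATE (director (729)): new notions (`muLog`,
`muToTorsionHom`, `kummerCupLevelClass`); everything else is imported and used BY NAME (`muSubgroupKummerClass` and its
API from `SubgroupKummerMu.lean`; `mapH1AddHom{,_oneCocycleClass,_resLe,_coresLe}` from `IwasawaH1Reduction.lean`;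
`CM.integralH1K`/`mem_integralH1K_iff` from `EllipticZetaReciprocity.lean`); nothing is re-declared.  CONSUMER BY
NAME: stage S4 of `Kato2004/EllipticUnitKummerCupMap.lean` (the corestricted classes
`c_{n,k} = cor_{U_s → Gal(K̄/Kℚ_n)}(κ_{U_s}(z_s^{1/p^k}) ∪ e_k)` of Kato's elliptic units, row K2C-8 (C5) of cell `bsd-cm`,
crux `EllipticUnitValueSevenOfGZK`) and S5 `Kato2004/EllipticUnitKummerCupClass.lean`.  HONEST FRAMING: coefficient
bookkeeping in Galois cohomology over an arbitrary field; nothing about any particular curve, CM or BSD; no summit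
statement is proved.

## References

* [Kato2004Asterisque] K. Kato, *p-adic Hodge theory and values of zeta functions of modular forms*, Astérisque 295
  (2004), §15.5 (p. 253: `𝕌`, `ℨ`, norm compatibility of `_𝔞z_{p^n𝔣}`), (15.6.1) (p. 253: `𝕌 ≅ 𝐇¹(ℤ_p(1))` by Kummer
  theory), §15.12 (15.12.1) (p. 263: the canonical homomorphism `𝐇¹(𝕌) ⊗ … → 𝐇¹(T)`).
* [Rubin2000] K. Rubin, *Euler Systems* (2000), III §3.3–§3.4 (cyclotomic / elliptic units as elements of
  `H¹(K_n, ℤ_p(1))`, twisting by characters / `T(−1)`), VI §1 (twists of Euler systems).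
* [SerreGaloisCohomology1997] J.-P. Serre, *Galois Cohomology* (1997), I §2.2–§2.4 (functoriality of `H¹` in the
  coefficients, res, cor), II §1.2 (Kummer theory).
* [Lang1983] S. Lang, *Fundamentals of Diophantine Geometry* (1983), Ch. 6 Prop. 1.3 (Kummer extensions by roots of
  units are unramified).
-/

noncomputable section

open scoped NumberField
open Field IsDedekindDomain
open Literature.NumberTheory.GaloisRepresentations
open Literature.NumberTheory.EllipticCurves
open WeierstrassCurve (geomPoints geomTorsion)

namespace Literature.NumberTheory.EllipticCurves.Kato2004

universe u

open DiscreteGaloisModule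

/-! ## §1 The discrete logarithm on `μ_N` and homomorphisms out of `μ_N` -/

section MuLog

variable (K : Type u) [Field K] (N : ℕ) [NeZero N]

variable {K N} in
/-- `muVal v` is an `N`-th root of unity, i.e. a power of a primitive one `ζ` (`μ_N(K̄) = ⟨ζ⟩`).
[cite: SerreGaloisCohomology1997, II §1.2] -/
theorem muVal_mem_zpowers {ζ : (AlgebraicClosure K)ˣ} (hζ : IsPrimitiveRoot ζ N) (v : MuCarrier K N) :
    muVal K N v ∈ Subgroup.zpowers ζ := by
  rw [hζ.zpowers_eq]
  exact ((MuCarrier.toAdditive v).toMul).2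

variable {K N} in
/-- Every element of `μ_N(K̄)` is `i • ζ` (additive notation of `MuCarrier`) for the generator `ζ`.
[cite: SerreGaloisCohomology1997, II §1.2] -/
theorem MuCarrier.exists_eq_nsmul_of_isPrimitiveRoot {ζ : (AlgebraicClosure K)ˣ} (hζ : IsPrimitiveRoot ζ N)
    (v : MuCarrier K N) :
    ∃ i : ℕ, i < N ∧ v = i • MuCarrier.ofRootsOfUnity ⟨ζ, hζ.mem_rootsOfUnity⟩ := by
  obtain ⟨i, hi, h⟩ := hζ.eq_pow_of_mem_rootsOfUnity ((MuCarrier.toAdditive v).toMul).2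
  exact ⟨i, hi, muVal_injective K N (by rw [muVal_nsmul, muVal_ofRootsOfUnity]; exact h.symm)⟩

variable {K N} in
/-- **Homomorphisms out of the cyclic group `μ_N(K̄) = ⟨ζ⟩` are determined by the image of `ζ`.**
[cite: SerreGaloisCohomology1997, II §1.2] -/
theorem MuCarrier.addMonoidHom_ext_of_isPrimitiveRoot {A : Type*} [AddCommMonoid A] {ζ : (AlgebraicClosure K)ˣ}
    (hζ : IsPrimitiveRoot ζ N) {f g : MuCarrier K N →+ A}
    (h : f (MuCarrier.ofRootsOfUnity ⟨ζ, hζ.mem_rootsOfUnity⟩) = g (MuCarrier.ofRootsOfUnity ⟨ζ, hζ.mem_rootsOfUnity⟩)) :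
    f = g := by
  ext v
  obtain ⟨i, -, rfl⟩ := MuCarrier.exists_eq_nsmul_of_isPrimitiveRoot hζ v
  rw [map_nsmul, map_nsmul, h]

variable {K N} in
/-- **A `σ ∈ Γ_K` fixing the generator `ζ` acts trivially on `μ_N(K̄)`** (`σζ^i = (σζ)^i`).
[cite: SerreGaloisCohomology1997, II §1.2] -/
theorem mu_apply_eq_self_of_smul_eq {ζ : (AlgebraicClosure K)ˣ} (hζ : IsPrimitiveRoot ζ N)
    {σ : absoluteGaloisGroup K} (hσ : σ • ζ = ζ) (v : MuCarrier K N) : mu K N σ v = v := by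
  apply muVal_injective K N
  obtain ⟨i, -, h⟩ := hζ.eq_pow_of_mem_rootsOfUnity ((MuCarrier.toAdditive v).toMul).2
  have hv : muVal K N v = ζ ^ i := h.symm
  rw [muVal_apply, hv, smul_pow', hσ]

/-- **The discrete logarithm `log_ζ : μ_N(K̄) → ℤ/N`** to the base of a primitive `N`-th root of unity `ζ`
(Mathlib `IsPrimitiveRoot.zmodEquivZPowers`, composed with `μ_N = ⟨ζ⟩`). [cite: SerreGaloisCohomology1997, II §1.2] -/
def muLog (ζ : (AlgebraicClosure K)ˣ) (hζ : IsPrimitiveRoot ζ N) : MuCarrier K N →+ ZMod N :=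
  (hζ.zmodEquivZPowers.symm : Additive (Subgroup.zpowers ζ) →+ ZMod N).comp
    { toFun := fun v ↦ Additive.ofMul ⟨muVal K N v, muVal_mem_zpowers hζ v⟩
      map_zero' := by
        change Additive.ofMul (⟨muVal K N 0, _⟩ : Subgroup.zpowers ζ) = Additive.ofMul 1
        exact congrArg _ (Subtype.ext (muVal_zero K N))
      map_add' := fun v w ↦ by
        change Additive.ofMul (⟨muVal K N (v + w), _⟩ : Subgroup.zpowers ζ) =
          Additive.ofMul (⟨muVal K N v, muVal_mem_zpowers hζ v⟩ * ⟨muVal K N w, muVal_mem_zpowers hζ w⟩)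
        exact congrArg _ (Subtype.ext (muVal_add K N v w)) }

/-- `log_ζ(ζ^i) = i`. [cite: SerreGaloisCohomology1997, II §1.2] -/
theorem muLog_pow (ζ : (AlgebraicClosure K)ˣ) (hζ : IsPrimitiveRoot ζ N) (i : ℕ) :
    muLog K N ζ hζ (MuCarrier.ofRootsOfUnity ⟨ζ ^ i, pow_mem hζ.mem_rootsOfUnity i⟩) = i := by
  change hζ.zmodEquivZPowers.symm (Additive.ofMul ⟨muVal K N (MuCarrier.ofRootsOfUnity ⟨ζ ^ i, _⟩), _⟩) = _
  have h : (⟨muVal K N (MuCarrier.ofRootsOfUnity ⟨ζ ^ i, pow_mem hζ.mem_rootsOfUnity i⟩),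
      muVal_mem_zpowers hζ _⟩ : Subgroup.zpowers ζ) = ⟨ζ ^ i, i, rfl⟩ := Subtype.ext rfl
  rw [h, hζ.zmodEquivZPowers_symm_apply_pow]

/-- `log_ζ(ζ) = 1`. [cite: SerreGaloisCohomology1997, II §1.2] -/
theorem muLog_gen (ζ : (AlgebraicClosure K)ˣ) (hζ : IsPrimitiveRoot ζ N) :
    muLog K N ζ hζ (MuCarrier.ofRootsOfUnity ⟨ζ, hζ.mem_rootsOfUnity⟩) = 1 := by
  have h : (MuCarrier.ofRootsOfUnity ⟨ζ, hζ.mem_rootsOfUnity⟩ : MuCarrier K N) =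
      MuCarrier.ofRootsOfUnity ⟨ζ ^ 1, pow_mem hζ.mem_rootsOfUnity 1⟩ :=
    muVal_injective K N (by rw [muVal_ofRootsOfUnity, muVal_ofRootsOfUnity]; exact (pow_one ζ).symm)
  rw [h, muLog_pow, Nat.cast_one]

end MuLog

/-! ## §2 The twisting homomorphism `t_{ζ,e} : μ_N → E[N]`, `ζ^a ↦ a • e` -/

section Twist

variable {K : Type u} [Field K] (E : WeierstrassCurve K) (N : ℕ) [NeZero N]

omit [NeZero N] in
/-- `N • e = 0` in `E[n]` for `e ∈ E[n]`, `n = N`. [folklore] -/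
private theorem natCast_zsmul_geomTorsion_eq_zero {n : ℤ} (hn : (N : ℤ) = n) (e : geomTorsion E n) :
    (N : ℤ) • e = 0 :=
  Subtype.ext (by
    rw [AddSubgroupClass.coe_zsmul, ZeroMemClass.coe_zero, hn]
    exact (Submodule.mem_torsionBy_iff (R := ℤ) _ _).mp e.2)

/-- ★ **The twisting homomorphism `t_{ζ,e} : μ_N(K̄) → E[N](K̄)`, `ζ^a ↦ a • e`** attached to a primitive `N`-th root
of unity `ζ` and an `N`-torsion point `e` (`= log_ζ(·) • e`, `ZMod.lift`): the finite-level, coordinate form of the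
twist `ℤ/N(1) ⊗ (ℤ/N(1))^{⊗−1} ⊗ E[N] = E[N]` by which Kato passes from `H¹(·, ℤ_p(1))` (Kummer theory of units,
(15.6.1)) to `H¹(·, T)` ((15.12.1)). [cite: Kato2004Asterisque, (15.6.1) (p. 253) and (15.12.1) (p. 263)]
[cite: Rubin2000, III §3.3 and VI §1] -/
def muToTorsionHom (ζ : (AlgebraicClosure K)ˣ) (hζ : IsPrimitiveRoot ζ N) {n : ℤ} (hn : (N : ℤ) = n)
    (e : geomTorsion E n) : MuCarrier K N →+ geomTorsion E n :=
  (ZMod.lift N ⟨zmultiplesHom (geomTorsion E n) e, by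
      rw [zmultiplesHom_apply]; exact natCast_zsmul_geomTorsion_eq_zero E N hn e⟩).comp (muLog K N ζ hζ)

/-- `t_{ζ,e}(ζ) = e`. [cite: Kato2004Asterisque, (15.12.1) (p. 263)] -/
@[simp] theorem muToTorsionHom_gen (ζ : (AlgebraicClosure K)ˣ) (hζ : IsPrimitiveRoot ζ N) {n : ℤ}
    (hn : (N : ℤ) = n) (e : geomTorsion E n) :
    muToTorsionHom E N ζ hζ hn e (MuCarrier.ofRootsOfUnity ⟨ζ, hζ.mem_rootsOfUnity⟩) = e := by
  rw [muToTorsionHom, AddMonoidHom.comp_apply, muLog_gen, ← Int.cast_one, ZMod.lift_coe]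
  change zmultiplesHom (geomTorsion E n) e 1 = e
  rw [zmultiplesHom_apply, one_zsmul]

/-- `t_{ζ,e}(ζ^i) = i • e`. [cite: Kato2004Asterisque, (15.12.1) (p. 263)] -/
theorem muToTorsionHom_pow (ζ : (AlgebraicClosure K)ˣ) (hζ : IsPrimitiveRoot ζ N) {n : ℤ} (hn : (N : ℤ) = n)
    (e : geomTorsion E n) (i : ℕ) :
    muToTorsionHom E N ζ hζ hn e (MuCarrier.ofRootsOfUnity ⟨ζ ^ i, pow_mem hζ.mem_rootsOfUnity i⟩) = i • e := by
  have h : (MuCarrier.ofRootsOfUnity ⟨ζ ^ i, pow_mem hζ.mem_rootsOfUnity i⟩ : MuCarrier K N) =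
      i • MuCarrier.ofRootsOfUnity ⟨ζ, hζ.mem_rootsOfUnity⟩ :=
    muVal_injective K N (by rw [muVal_nsmul, muVal_ofRootsOfUnity, muVal_ofRootsOfUnity])
  rw [h, map_nsmul, muToTorsionHom_gen]

/-- **`t_{ζ,e}` is `σ`-equivariant for every `σ ∈ Γ_K` fixing `ζ` and `e`** (both sides have trivial `σ`-action:
`σ` fixes `μ_N = ⟨ζ⟩` and the multiples of `e`). [cite: Kato2004Asterisque, §15.12 (p. 263)] [cite: Rubin2000, VI §1] -/
theorem muToTorsionHom_smul (ζ : (AlgebraicClosure K)ˣ) (hζ : IsPrimitiveRoot ζ N) {n : ℤ} (hn : (N : ℤ) = n)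
    (e : geomTorsion E n) {σ : absoluteGaloisGroup K} (hσζ : σ • ζ = ζ) (hσe : σ • e = e) (v : MuCarrier K N) :
    muToTorsionHom E N ζ hζ hn e (mu K N σ v) = σ • muToTorsionHom E N ζ hζ hn e v := by
  rw [mu_apply_eq_self_of_smul_eq hζ hσζ]
  obtain ⟨i, -, rfl⟩ := MuCarrier.exists_eq_nsmul_of_isPrimitiveRoot hζ v
  rw [map_nsmul, muToTorsionHom_gen, ← WeierstrassCurve.torsionGaloisRepresentation_apply_apply, map_nsmul,
    WeierstrassCurve.torsionGaloisRepresentation_apply_apply, hσe]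

/-- **The level-change square `f ∘ t_{ζ',e'} = t_{ζ,e} ∘ π`.**  For levels `M = N·d`, primitive roots `ζ'` (order `M`)
and `ζ = ζ'^d` (order `N`), torsion points `e' ∈ E[M]`, `e ∈ E[N]` with `d • e' = e`, any «power» map `π : μ_M → μ_N`
with `π(v) = v^d` in `K̄ˣ` (e.g. `muPowMap`) and any homomorphism `f : E[M] → E[N]` with `f(P) = d • P` (e.g.
`geomTorsionReduce`, `d = p`): `f (t_{ζ',e'} v) = t_{ζ,e} (π v)` — both homomorphisms out of `μ_M = ⟨ζ'⟩` send `ζ'` to `e`.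
This is the `p_*`-compatibility of Kato's classes in the level. [cite: Kato2004Asterisque, §8.2 (p. 181) and (15.12.1) (p. 263)]
[cite: Rubin2000, App. B Prop. B.2.3] -/
theorem comp_muToTorsionHom_eq {M : ℕ} [NeZero M] (d : ℕ) (ζ' : (AlgebraicClosure K)ˣ) (hζ' : IsPrimitiveRoot ζ' M)
    (ζ : (AlgebraicClosure K)ˣ) (hζ : IsPrimitiveRoot ζ N) (hζζ' : ζ' ^ d = ζ) {m n : ℤ} (hm : (M : ℤ) = m)
    (hn : (N : ℤ) = n) (e' : geomTorsion E m) (e : geomTorsion E n) (hee' : (d : ℤ) • (e' : geomPoints E) = e)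
    (π : MuCarrier K M →+ MuCarrier K N) (hπ : ∀ v, muVal K N (π v) = muVal K M v ^ d)
    (f : geomTorsion E m →+ geomTorsion E n) (hf : ∀ P, (f P : geomPoints E) = (d : ℤ) • (P : geomPoints E)) :
    f.comp (muToTorsionHom E M ζ' hζ' hm e') = (muToTorsionHom E N ζ hζ hn e).comp π := by
  refine MuCarrier.addMonoidHom_ext_of_isPrimitiveRoot hζ' ?_
  rw [AddMonoidHom.comp_apply, AddMonoidHom.comp_apply, muToTorsionHom_gen]
  have hπζ : π (MuCarrier.ofRootsOfUnity ⟨ζ', hζ'.mem_rootsOfUnity⟩) =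
      MuCarrier.ofRootsOfUnity ⟨ζ, hζ.mem_rootsOfUnity⟩ :=
    muVal_injective K N (by rw [hπ, muVal_ofRootsOfUnity, muVal_ofRootsOfUnity, hζζ'])
  rw [hπζ, muToTorsionHom_gen]
  exact Subtype.ext (by rw [hf, hee'])

end Twist

/-! ## §3 The Kummer–cup class `κ_U(β) ∪ e = (t_{ζ,e})_* κ_U(β) ∈ H¹(U, E[N])` -/

section LevelClass

variable {K : Type} [Field K] (E : WeierstrassCurve K) (N : ℕ) [NeZero N]
  (U : Subgroup (absoluteGaloisGroup K)) (ζ : (AlgebraicClosure K)ˣ) (hζ : IsPrimitiveRoot ζ N)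
  {n : ℤ} (hn : (N : ℤ) = n) (e : geomTorsion E n)

/-- `t_{ζ,e}` intertwines the restrictions to `U` of `μ_N` and `E[N]` when `U` fixes `ζ` and `e` (the hypothesis of
`mapH1AddHom` on the layer). [cite: Kato2004Asterisque, §15.12 (p. 263)] -/
theorem muToTorsionHom_subgroupRep (hUζ : ∀ σ : U, (σ : absoluteGaloisGroup K) • ζ = ζ)
    (hUe : ∀ σ : U, (σ : absoluteGaloisGroup K) • e = e) (g : U) (v : MuCarrier K N) :
    muToTorsionHom E N ζ hζ hn e ((subgroupRep (mu K N).toTopRep U).ρ g v) =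
      (subgroupRep (E.torsionGaloisModule n).toTopRep U).ρ g (muToTorsionHom E N ζ hζ hn e v) :=
  muToTorsionHom_smul E N ζ hζ hn e (hUζ g) (hUe g) v

/-- ★ **The Kummer–cup class `κ_U(β) ∪ e ∈ H¹(U, E[N])`** of a Kummer unit `β` of `U` (`β^N ∈ (K̄^U)ˣ`), for a
subgroup `U ≤ Γ_K` fixing the primitive root `ζ` and the torsion point `e`: the push-forward `(t_{ζ,e})_* κ_U(β)` of the
subgroup Kummer class `κ_U(β) ∈ H¹(U, μ_N)` along `ζ^a ↦ a • e` — on cocycles `σ ↦ log_ζ(σβ/β) • e`.  At `U = U_s =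
Gal(K̄/K(p^s𝔣))`, `N = p^k`, `β^{p^k} = _𝔞z_{p^s𝔣}`, `e = e_k` this is the level-`(s,k)` value of Kato's (15.6.1)∘(15.12.1)
on the elliptic unit. [cite: Kato2004Asterisque, (15.6.1) (p. 253) and (15.12.1) (p. 263)] [cite: Rubin2000, III §3.3] -/
def kummerCupLevelClass (hUζ : ∀ σ : U, (σ : absoluteGaloisGroup K) • ζ = ζ)
    (hUe : ∀ σ : U, (σ : absoluteGaloisGroup K) • e = e) (β : subgroupKummerUnits K N U) : H1 (E.torsionGaloisModule n) U :=
  mapH1AddHom (subgroupRep (mu K N).toTopRep U) (subgroupRep (E.torsionGaloisModule n).toTopRep U)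
    (muToTorsionHom E N ζ hζ hn e) continuous_of_discreteTopology (muToTorsionHom_subgroupRep E N U ζ hζ hn e hUζ hUe)
    (muSubgroupKummerClass K N U β)

/-- Unfolding: `κ_U(β) ∪ e = (t_{ζ,e})_* κ_U(β)`. [cite: Kato2004Asterisque, (15.12.1) (p. 263)] -/
theorem kummerCupLevelClass_def (hUζ : ∀ σ : U, (σ : absoluteGaloisGroup K) • ζ = ζ)
    (hUe : ∀ σ : U, (σ : absoluteGaloisGroup K) • e = e) (β : subgroupKummerUnits K N U) :
    kummerCupLevelClass E N U ζ hζ hn e hUζ hUe β =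
      mapH1AddHom (subgroupRep (mu K N).toTopRep U) (subgroupRep (E.torsionGaloisModule n).toTopRep U)
        (muToTorsionHom E N ζ hζ hn e) continuous_of_discreteTopology
        (muToTorsionHom_subgroupRep E N U ζ hζ hn e hUζ hUe) (muSubgroupKummerClass K N U β) :=
  rfl

/-- The Kummer–cup class on an explicit cocycle: `κ_U(β) ∪ e = [σ ↦ t_{ζ,e}(σβ/β)]`.
[cite: Kato2004Asterisque, (15.12.1) (p. 263)] [cite: SerreGaloisCohomology1997, I §2.2] -/
theorem kummerCupLevelClass_eq_oneCocycleClass (hUζ : ∀ σ : U, (σ : absoluteGaloisGroup K) • ζ = ζ)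
    (hUe : ∀ σ : U, (σ : absoluteGaloisGroup K) • e = e) (β : subgroupKummerUnits K N U) :
    kummerCupLevelClass E N U ζ hζ hn e hUζ hUe β =
      oneCocycleClass (subgroupRep (E.torsionGaloisModule n).toTopRep U)
        (contOneCocycles.pushAddHom (muToTorsionHom E N ζ hζ hn e) continuous_of_discreteTopology
          (muToTorsionHom_subgroupRep E N U ζ hζ hn e hUζ hUe) (muSubgroupKummerCocycle K N U β)) := by
  rw [kummerCupLevelClass, muSubgroupKummerClass, mapH1AddHom_oneCocycleClass]

/-- Additivity in `β`: `κ_U(ββ') ∪ e = κ_U(β) ∪ e + κ_U(β') ∪ e`. [cite: Kato2004Asterisque, (15.6.1) (p. 253)] -/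
theorem kummerCupLevelClass_mul (hUζ : ∀ σ : U, (σ : absoluteGaloisGroup K) • ζ = ζ)
    (hUe : ∀ σ : U, (σ : absoluteGaloisGroup K) • e = e) (β β' : subgroupKummerUnits K N U) :
    kummerCupLevelClass E N U ζ hζ hn e hUζ hUe (β * β') =
      kummerCupLevelClass E N U ζ hζ hn e hUζ hUe β + kummerCupLevelClass E N U ζ hζ hn e hUζ hUe β' := by
  rw [kummerCupLevelClass, muSubgroupKummerClass_mul, map_add]
  rfl

/-- **`κ_U(β) ∪ e` depends on `β^N` only** (so it is a function of the unit `b = β^N` of the layer).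
[cite: Kato2004Asterisque, (15.6.1) (p. 253)] [cite: SerreGaloisCohomology1997, II §1.2] -/
theorem kummerCupLevelClass_eq_of_pow_eq (hUζ : ∀ σ : U, (σ : absoluteGaloisGroup K) • ζ = ζ)
    (hUe : ∀ σ : U, (σ : absoluteGaloisGroup K) • e = e) {β β' : subgroupKummerUnits K N U}
    (h : (β : (AlgebraicClosure K)ˣ) ^ N = (β' : (AlgebraicClosure K)ˣ) ^ N) :
    kummerCupLevelClass E N U ζ hζ hn e hUζ hUe β = kummerCupLevelClass E N U ζ hζ hn e hUζ hUe β' := by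
  rw [kummerCupLevelClass, kummerCupLevelClass, muSubgroupKummerClass_eq_of_pow_eq h]

/-- The class of a `U`-fixed `β` vanishes. [cite: SerreGaloisCohomology1997, II §1.2] -/
theorem kummerCupLevelClass_eq_zero_of_forall_smul_eq (hUζ : ∀ σ : U, (σ : absoluteGaloisGroup K) • ζ = ζ)
    (hUe : ∀ σ : U, (σ : absoluteGaloisGroup K) • e = e) (β : subgroupKummerUnits K N U)
    (hβ : ∀ σ : U, (σ : absoluteGaloisGroup K) • (β : (AlgebraicClosure K)ˣ) = β) :
    kummerCupLevelClass E N U ζ hζ hn e hUζ hUe β = 0 := by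
  rw [kummerCupLevelClass, muSubgroupKummerClass_eq_zero_of_forall_smul_eq β hβ, map_zero]

/-- Multiplying `β` by a `U`-fixed unit does not change the class. [cite: SerreGaloisCohomology1997, II §1.2] -/
theorem kummerCupLevelClass_mul_of_forall_smul_eq (hUζ : ∀ σ : U, (σ : absoluteGaloisGroup K) • ζ = ζ)
    (hUe : ∀ σ : U, (σ : absoluteGaloisGroup K) • e = e) (β c : subgroupKummerUnits K N U)
    (hc : ∀ σ : U, (σ : absoluteGaloisGroup K) • (c : (AlgebraicClosure K)ˣ) = c) :
    kummerCupLevelClass E N U ζ hζ hn e hUζ hUe (β * c) = kummerCupLevelClass E N U ζ hζ hn e hUζ hUe β := by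
  rw [kummerCupLevelClass_mul, kummerCupLevelClass_eq_zero_of_forall_smul_eq E N U ζ hζ hn e hUζ hUe c hc, add_zero]

/-! ### Restriction and corestriction between subgroups fixing `ζ` and `e` -/

/-- **Restriction to a smaller subgroup**: `res_{U'}^{U}(κ_U(β) ∪ e) = κ_{U'}(β) ∪ e` for `U' ≤ U`.
[cite: SerreGaloisCohomology1997, I §2.4] [cite: Kato2004Asterisque, §8.2 (p. 181)] -/
theorem resLe_kummerCupLevelClass (hUζ : ∀ σ : U, (σ : absoluteGaloisGroup K) • ζ = ζ)
    (hUe : ∀ σ : U, (σ : absoluteGaloisGroup K) • e = e) {U' : Subgroup (absoluteGaloisGroup K)} (h : U' ≤ U)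
    (β : subgroupKummerUnits K N U) :
    resLe (E.torsionGaloisModule n).toTopRep h 1 (kummerCupLevelClass E N U ζ hζ hn e hUζ hUe β) =
      kummerCupLevelClass E N U' ζ hζ hn e (fun σ : U' ↦ hUζ ⟨(σ : absoluteGaloisGroup K), h σ.2⟩)
        (fun σ : U' ↦ hUe ⟨(σ : absoluteGaloisGroup K), h σ.2⟩)
        ⟨β, subgroupKummerUnits_anti K N h β.2⟩ := by
  rw [kummerCupLevelClass, kummerCupLevelClass, ← resLe_muSubgroupKummerClass K N U h β]
  exact (mapH1AddHom_resLe (X := (mu K N).toTopRep) (Y := (E.torsionGaloisModule n).toTopRep)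
    (muToTorsionHom E N ζ hζ hn e) continuous_of_discreteTopology h _ _ _).symm

variable {U} {U' : Subgroup (absoluteGaloisGroup K)} [Fintype (U' ⧸ U.subgroupOf U')] {s : U' ⧸ U.subgroupOf U' → U'}

/-- **Corestriction between two subgroups both fixing `ζ` and `e`** (`U ≤ U'`, `U` open of finite index in `U'`; e.g.
the Kummer levels `Gal(K̄/K(p^{s'}𝔣)) ≤ Gal(K̄/K(p^s𝔣))`, `s' ≥ s ≥ k`): `cor_{U'/U}(κ_U(β) ∪ e) = κ_{U'}(∏ₓ s(x)·β) ∪ e`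
(`f_*` commutes with `cor` — `mapH1AddHom_coresLe` — and `cor ∘ κ_U = κ_{U'} ∘ norm`, `coresLe_muSubgroupKummerClass`).
[cite: Kato2004Asterisque, §15.5 (p. 253)] [cite: NeukirchSchmidtWingberg2008, I §5] -/
theorem coresLe_kummerCupLevelClass (h : U ≤ U') (hU : IsOpen (U : Set (absoluteGaloisGroup K)))
    (hs : ∀ x, (s x : U' ⧸ U.subgroupOf U') = x)
    (hU'ζ : ∀ σ : U', (σ : absoluteGaloisGroup K) • ζ = ζ) (hU'e : ∀ σ : U', (σ : absoluteGaloisGroup K) • e = e)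
    (β : subgroupKummerUnits K N U) :
    coresLe (E.torsionGaloisModule n).toTopRep h hU
        (kummerCupLevelClass E N U ζ hζ hn e (fun σ : U ↦ hU'ζ ⟨(σ : absoluteGaloisGroup K), h σ.2⟩)
          (fun σ : U ↦ hU'e ⟨(σ : absoluteGaloisGroup K), h σ.2⟩) β) =
      kummerCupLevelClass E N U' ζ hζ hn e hU'ζ hU'e
        ⟨∏ x : U' ⧸ U.subgroupOf U', ((s x : U') : absoluteGaloisGroup K) • (β : (AlgebraicClosure K)ˣ),
          prod_smul_mem_subgroupKummerUnits hs β.2⟩ := by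
  rw [kummerCupLevelClass, kummerCupLevelClass, ← coresLe_muSubgroupKummerClass K N h hU hs β]
  exact (mapH1AddHom_coresLe (X := (mu K N).toTopRep) (Y := (E.torsionGaloisModule n).toTopRep)
    (muToTorsionHom E N ζ hζ hn e) continuous_of_discreteTopology h hU _ _ _).symm

/-- Root-free form: `cor_{U'/U}(κ_U(β) ∪ e) = κ_{U'}(α) ∪ e` for ANY Kummer unit `α` of `U'` with `α^N = ∏ₓ s(x)·β^N`
(= the norm of `b = β^N`; e.g. `α^{p^k} = _𝔞z_{p^s𝔣} = N(_𝔞z_{p^{s'}𝔣})`, Kato §15.5).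
[cite: Kato2004Asterisque, §15.5 (p. 253)] [cite: NeukirchSchmidtWingberg2008, I §5] -/
theorem coresLe_kummerCupLevelClass_eq_of_pow_eq (h : U ≤ U') (hU : IsOpen (U : Set (absoluteGaloisGroup K)))
    (hs : ∀ x, (s x : U' ⧸ U.subgroupOf U') = x)
    (hU'ζ : ∀ σ : U', (σ : absoluteGaloisGroup K) • ζ = ζ) (hU'e : ∀ σ : U', (σ : absoluteGaloisGroup K) • e = e)
    (β : subgroupKummerUnits K N U) (α : subgroupKummerUnits K N U')
    (hα : (α : (AlgebraicClosure K)ˣ) ^ N =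
      ∏ x : U' ⧸ U.subgroupOf U', ((s x : U') : absoluteGaloisGroup K) • (β : (AlgebraicClosure K)ˣ) ^ N) :
    coresLe (E.torsionGaloisModule n).toTopRep h hU
        (kummerCupLevelClass E N U ζ hζ hn e (fun σ : U ↦ hU'ζ ⟨(σ : absoluteGaloisGroup K), h σ.2⟩)
          (fun σ : U ↦ hU'e ⟨(σ : absoluteGaloisGroup K), h σ.2⟩) β) =
      kummerCupLevelClass E N U' ζ hζ hn e hU'ζ hU'e α := by
  rw [coresLe_kummerCupLevelClass E N ζ hζ hn e h hU hs hU'ζ hU'e β]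
  exact kummerCupLevelClass_eq_of_pow_eq E N U' ζ hζ hn e hU'ζ hU'e (by rw [hα]; exact prod_smul_pow_eq _)

/-! ### Change of level: `f_*(κ_{U,M}(β') ∪ e') = κ_{U,N}(β'^d) ∪ e` -/

variable (U) in
/-- **Change of level** (`p_*`-compatibility brick): for `M = N·d`, `ζ = ζ'^d`, `d • e' = e`, and a homomorphism
`f : E[M] → E[N]` with `f(P) = d • P` (equivariant for `Γ_K`), `f_*(κ_{U,M}(β') ∪_{ζ'} e') = κ_{U,N}(β'^d) ∪_ζ e` in
`H¹(U, E[N])` — on cocycles `f(t_{ζ',e'}(σβ'/β')) = t_{ζ,e}((σβ'/β')^d) = t_{ζ,e}(σβ'^d/β'^d)` (`comp_muToTorsionHom_eq` +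
`map_muSubgroupKummerCocycle_apply`).  With `d = p`, `f = geomTorsionReduce`: `p_*(c_{k+1}) = c_k` when the roots are
chosen with `β_k^{p^k} = β_{k+1}^{p^{k+1}}` (class level, `kummerCupLevelClass_eq_of_pow_eq`).
[cite: Kato2004Asterisque, §8.2 (p. 181) and (15.12.1) (p. 263)] [cite: Rubin2000, App. B Prop. B.2.3] -/
theorem mapH1AddHom_kummerCupLevelClass_of_pow (hUζ : ∀ σ : U, (σ : absoluteGaloisGroup K) • ζ = ζ)
    (hUe : ∀ σ : U, (σ : absoluteGaloisGroup K) • e = e) {M : ℕ} [NeZero M] (d : ℕ) (hM : N * d = M)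
    (ζ' : (AlgebraicClosure K)ˣ) (hζ' : IsPrimitiveRoot ζ' M) (hζζ' : ζ' ^ d = ζ) {m : ℤ} (hm : (M : ℤ) = m)
    (e' : geomTorsion E m) (hee' : (d : ℤ) • (e' : geomPoints E) = e)
    (hUζ' : ∀ σ : U, (σ : absoluteGaloisGroup K) • ζ' = ζ') (hUe' : ∀ σ : U, (σ : absoluteGaloisGroup K) • e' = e')
    (f : geomTorsion E m →+ geomTorsion E n) (hf : ∀ P, (f P : geomPoints E) = (d : ℤ) • (P : geomPoints E))
    (hfU : ∀ (g : U) (P : geomTorsion E m),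
      f ((subgroupRep (E.torsionGaloisModule m).toTopRep U).ρ g P) =
        (subgroupRep (E.torsionGaloisModule n).toTopRep U).ρ g (f P))
    (β' : subgroupKummerUnits K M U) :
    mapH1AddHom (subgroupRep (E.torsionGaloisModule m).toTopRep U)
        (subgroupRep (E.torsionGaloisModule n).toTopRep U) f continuous_of_discreteTopology hfU
        (kummerCupLevelClass E M U ζ' hζ' hm e' hUζ' hUe' β') =
      kummerCupLevelClass E N U ζ hζ hn e hUζ hUe
        ⟨(β' : (AlgebraicClosure K)ˣ) ^ d, pow_mem_subgroupKummerUnits_of_mul_eq hM β'.2⟩ := by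
  -- a power map `π : μ_M → μ_N` exists in the tree (`muPowMap`); we only need its values, so we build it inline
  let π : MuCarrier K M →+ MuCarrier K N :=
    { toFun := fun v ↦ MuCarrier.ofRootsOfUnity ⟨muVal K M v ^ d, by
        rw [mem_rootsOfUnity, ← pow_mul, mul_comm, hM]; exact muVal_pow_eq_one K M v⟩
      map_zero' := muVal_injective K N (by simp)
      map_add' := fun v w ↦ muVal_injective K N (by simp [mul_pow]) }
  have hπ : ∀ v, muVal K N (π v) = muVal K M v ^ d := fun v ↦ rfl
  have hcomp := comp_muToTorsionHom_eq E N d ζ' hζ' ζ hζ hζζ' hm hn e' e hee' π hπ f hf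
  rw [kummerCupLevelClass_eq_oneCocycleClass, kummerCupLevelClass_eq_oneCocycleClass, mapH1AddHom_oneCocycleClass]
  refine congrArg _ (Subtype.ext (ContinuousMap.ext fun σ ↦ ?_))
  rw [contOneCocycles.pushAddHom_apply, contOneCocycles.pushAddHom_apply, contOneCocycles.pushAddHom_apply,
    ← AddMonoidHom.comp_apply, hcomp, AddMonoidHom.comp_apply, map_muSubgroupKummerCocycle_apply K N U d hM π hπ β' σ]

/-! ### Integrality: `κ_U(β) ∪ e ∈ H¹(O_{K̄^U}[1/p], E[p^k])` for a `p`-unit `b = β^{p^k}` -/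

variable (U) in
/-- ★ **Integrality of the Kummer–cup class** (`N = p^k`): if, at every prime `𝔓 ∤ p` of `ℤ̄_K`, `β` times some
`U`-fixed unit `c` is an algebraic integer outside `𝔓` (so for `β` an `N`-th root of a unit of `O_{K̄^U}[1/p]`:
take `c` a power of `p`), then `κ_U(β) ∪ e ∈ CM.integralH1K (E.torsionGaloisModule (p^k)) p U = H¹(O_{K̄^U}[1/p], E[p^k])`:
the restriction to `U ⊓ I_𝔓` is `(t_{ζ,e})_*` of `res κ_U(βc) = 0` (`resLe_inf_inertia_muSubgroupKummerClass`: Kummer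
extensions by roots of `𝔓`-units are unramified at `𝔓 ∤ N`).  Kato: the elliptic units lie in `O_{K'}[1/p]^×` and
`𝕌 = lim H¹(O_{K'}[1/p], ℤ_p(1))`. [cite: Kato2004Asterisque, §15.5–§15.6 (p. 253) and §8.2 (pp. 180–181)] [cite:
Lang1983, Ch. 6 Prop. 1.3] -/
theorem kummerCupLevelClass_mem_integralH1K (p k : ℕ) [NeZero (p ^ k)] (ζk : (AlgebraicClosure K)ˣ)
    (hζk : IsPrimitiveRoot ζk (p ^ k)) {nk : ℤ} (hnk : ((p ^ k : ℕ) : ℤ) = nk) (ek : geomTorsion E nk)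
    (hUζk : ∀ σ : U, (σ : absoluteGaloisGroup K) • ζk = ζk) (hUek : ∀ σ : U, (σ : absoluteGaloisGroup K) • ek = ek)
    (β : subgroupKummerUnits K (p ^ k) U)
    (hβ : ∀ v : HeightOneSpectrum (𝓞 K), ((p : ℕ) : 𝓞 K) ∉ v.asIdeal → ∀ 𝔓 ∈ v.primesAbove,
      ∃ c : subgroupKummerUnits K (p ^ k) U, (∀ σ : U, (σ : absoluteGaloisGroup K) • (c : (AlgebraicClosure K)ˣ) = c) ∧
        ∃ α : absIntegers (𝓞 K) K,
          (α : AlgebraicClosure K) = (((β * c : subgroupKummerUnits K (p ^ k) U) : (AlgebraicClosure K)ˣ) :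
            AlgebraicClosure K) ∧ α ∉ 𝔓) :
    kummerCupLevelClass E (p ^ k) U ζk hζk hnk ek hUζk hUek β ∈
      CM.integralH1K (E.torsionGaloisModule nk) p U := by
  rw [CM.mem_integralH1K_iff]
  intro v hv 𝔓 h𝔓
  obtain ⟨c, hc, α, hαβ, hα𝔓⟩ := hβ v hv 𝔓 h𝔓
  haveI : 𝔓.IsPrime := (HeightOneSpectrum.mem_primesAbove_iff.mp h𝔓).1
  haveI : 𝔓.LiesOver v.asIdeal := (HeightOneSpectrum.mem_primesAbove_iff.mp h𝔓).2
  have hN𝔓 : (((p ^ k : ℕ) : ℕ) : absIntegers (𝓞 K) K) ∉ 𝔓 := by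
    intro hmem
    have h1 : algebraMap (𝓞 K) (absIntegers (𝓞 K) K) ((p : 𝓞 K) ^ k) ∈ 𝔓 := by
      rw [map_pow, map_natCast]; exact_mod_cast hmem
    rw [← Ideal.mem_comap, ← Ideal.under_def, ← Ideal.LiesOver.over (P := 𝔓) (p := v.asIdeal)] at h1
    exact hv (v.isPrime.mem_of_pow_mem k h1)
  rw [← kummerCupLevelClass_mul_of_forall_smul_eq E (p ^ k) U ζk hζk hnk ek hUζk hUek β c hc, resLe_kummerCupLevelClass,
    kummerCupLevelClass, ← resLe_muSubgroupKummerClass K (p ^ k) U inf_le_left,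
    resLe_inf_inertia_muSubgroupKummerClass (β * c) hN𝔓 hαβ hα𝔓, map_zero]

end LevelClass

end Literature.NumberTheory.EllipticCurves.Kato2004

end
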